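import Summits.QuantumFields.BalabanUV.Beta.D1BFx.RColumnBlockMass

/-!
# `BalabanUV.Beta.D1BFx.RColumnProfile` — road «BF-x» for binder row D1, slot (K), END row `hGrp gN`, «GN-L3» PART 2d (owner ruling ρ-g9-33 (L2)∕(L3);
# an3-g58 [AN3-G58-GNL3-2] F2): THE ASSEMBLED POINTWISE PROFILE OF THE R-COLUMN `ρ_s = RG (Ggh n a) (Pgt n a) (·, s)` AND OF ITS x-GRADIENT,
# `|RG(x,s)| ≤ kV(a)∕n² · e^{−(dR(a)∕2∕n)‖x−s‖∞} ∕ nrm(x−s)²`, `|RG(x+e_ρ,s) − RG(x,s)| ≤ kP(a)∕n² · e^{−(dR(a)∕2∕n)‖x−s‖∞} ∕ nrm(x−s)³` — EVERY `x` (diagonal included),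
# in the profile currency of leaf-04-g9's `LatticeHLSProfiles` (`A·e^{−(δ∕n)‖x−v‖∞}∕nrm(x−v)^b`, `nrm = PoissonInterior.nrm`)

HONEST DEPENDENCY (cell records, verbatim): «continuum YM on T⁴ ⇐ BetaPertH ∧ nine spine estimates (0/9 proved); BetaPertH ⇐ (D1) ∧ (D4) ∧
CAP+tail; G-an2-4 gates asym, D1 and NE2/3/4.»  HONEST FRAMING (cell contract, verbatim): «discharging `BetaPertH` makes Bałaban's UV stability
UNCONDITIONAL — a real constructive-QFT result; it is NOT the continuum limit and NOT the Clay problem.»  THIS MODULE DISCHARGES NOTHING of the wall: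
[folklore] pointwise assembly BY NAME of hypothesis-free tree envelopes — the Coulomb cores `GhostLegBlockMass.abs_Ggh_le_of_ne` (`ghost_d0`),
`GhostLegBlockMassD1.abs_Ggh_le_sharp`∕`abs_Ggh_diff_le_of_ne` (`ghost_h0`∕`ghost_d1`), the projector sups `ProjectorSupNorm.abs_Pgt_le_sup`∕`abs_Pgt_diff_le_sup`, the M10
block column `RColumnBlockMass.sum_B_abs_Ggh_col_le` and the block convolution `RColumnBlockMass.sum_abs_tsum_le_conv`; no `def … : Prop`, no hypothesis is a printed
statement, 0 binders of row D1 touched; (K) NOT closed; NOT (CONV-C), NOT D1, NOT BetaPertH, NOT continuum, NOT Clay.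

WHY (an3-g57 §3′ (2) «R-column envelope `k·(n⁻²·nrm(x−s)⁻²·e^{−(δ∕n)|x−s|} + n⁻⁴·e^{−δ′·bd})`, first differences `k·(n⁻²nrm⁻³e^{…} + n⁻⁵e^{…})`»;
an3-g58 F2 «the ASSEMBLED POINTWISE (L2) PROFILE of the R-column has no named letter» — GN-L5's kernel∘profile corollaries take PROFILE hypotheses).
PARTS 2a–2c are MASSES; this part absorbs the smooth `Pgt∘Ggh` term (`cSm∕n⁴·e^{−dR·dist(blk x, blk s)}`, one block convolution) into the Coulomb
profile with `‖x−s‖∞ + 1 ≤ n·(dist(blk x, blk s)+1)` and `(D+1)^p e^{−(dR∕2)D} ≤ (1+2p∕dR)^p`, keeping half of the block decay as damping (rate `dR∕2`).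
CONTENT ([folklore]; `blk = blk (n−1)`, `X 4 = Pt = Fin 4 → ℤ`, `nrm`∕`supNorm` of `PoissonInterior` (`DyadicShell.supNorm = PoissonInterior.supNorm` by `rfl`,
`GhostLegFree.supNorm_eq`); `[NeZero n]`, `0 < a`; constants **`cSm a := cPPs(4,a)·cNear a·K₄(ghDelta a∕2)`**, **`cAbs p a := (1 + 2p∕dR a)^p·e^{dR a∕2}`**,
**`kV a := ghA0 a + (cG0 4 + cSplit 4 a) + cSm a·cAbs 2 a`**, **`kP a := ghA1 a + 2(cG0 4 + cSplit 4 a) + cSm a·cAbs 3 a`**):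
§1 the smooth part **`abs_comp_le`** (`|Σ'_z Pgt x z·Ggh z s| ≤ cSm∕n⁴·e^{−dR·dist(blk x, blk s)}`), **`abs_comp_diff_le`** (`≤ cSm∕n⁵·e^{…}`); §2 geometry `nrm_sub_le`
and absorption `pow_succ_mul_exp_le`, `absorb`; §3 THE PROFILES **`abs_RG_le_profile`**, **`abs_RG_diff_le_profile`** and the undamped corollaries **`abs_RG_le_inv_sq`**,
**`abs_RG_diff_le_inv_cube`** (`A∕nrm(x−s)^b`, `A = kV∕n²`, `kP∕n²` — the `hf`∕`hK` inputs of `LatticeHLSProfiles.abs_tsum_mul_le_of_profiles(_crit)`).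
NOT HERE: the `s`-gradient profile (`δρ`; on request); the thin-needle profile `Φ_u`; any END row.  Unit `b2b-balaban-gan24-formalise-leaf-05` (gen 41), G-an2-4 swarm leaf prover on cross-lane kernel duty; `LEAVES-BFx.md` row (N) «GN-L3» PART 2d.
-/

namespace Summit.QuantumFields.BalabanUV.Beta.D1BFx.RColumnProfile

open Finset
open scoped BigOperators
open Literature.MathematicalPhysics.QuantumFieldTheory.Balaban1983to89
open Literature.MathematicalPhysics.QuantumFieldTheory.Balaban1983to89.Beta
open B4Sect5Proof (latticeConst latticeConst_nonneg)
open B6QGQLower276 (X e blk B mem_B)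
open Beta.PoissonInterior (nrm one_le_nrm nrm_pos supNorm_eq_zero_iff natAbs_le_supNorm)
open DyadicShell (Pt supNorm)
open AffineAveraging (unitVec)
open Summit.QuantumFields.BalabanUV.Beta.D1BFx.RProjector (Pgt deltaPP deltaPP_pos)
open Summit.QuantumFields.BalabanUV.Beta.D1BFx.ProjectorSupNorm (cPPs cPPs_nonneg abs_Pgt_le_sup abs_Pgt_diff_le_sup)
open Summit.QuantumFields.BalabanUV.Beta.D1BFx.GhostLeg (Ggh cast_pred_add_one)
open Summit.QuantumFields.BalabanUV.Beta.D1BFx.RProjectorJet (RG)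
open Summit.QuantumFields.BalabanUV.Beta.D1BFx.RdotBlockRange (summable_Pgt_mul_Ggh)
open Summit.QuantumFields.BalabanUV.Beta.D1BFx.GhostLegFree (ghA0 ghA1 ghDelta ghDelta_pos natAbs_sub_le_blk nrm_eq_supNorm supNorm_eq)
open Summit.QuantumFields.BalabanUV.Beta.D1BFx.PointColumnSplit (cG0 cG0_nonneg cSplit cSplit_nonneg)
open Summit.QuantumFields.BalabanUV.Beta.D1BFx.GhostLegBlockMass (cNear ghA0_pos abs_Ggh_le_of_ne dist_eq_supNorm)
open Summit.QuantumFields.BalabanUV.Beta.D1BFx.GhostLegBlockMassD1 (cNear1 ghA1_nonneg abs_Ggh_le_sharp abs_Ggh_diff_le_of_ne)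
open Summit.QuantumFields.BalabanUV.Beta.D1BFx.RColumnBlockMass (dR dR_pos cNear_nonneg RG_apply sum_abs_tsum_le_conv sum_B_abs_Ggh_col_le)

noncomputable section

/-- [our constant] The smooth-part constant `cPPs·cNear·K₄(ghDelta∕2)`. -/
def cSm (a : ℝ) : ℝ := cPPs 4 a * cNear a * latticeConst 4 (ghDelta a / 2)

/-- [our constant] The absorption constant `(1 + 2p∕dR)^p·e^{dR∕2}`. -/
def cAbs (p : ℕ) (a : ℝ) : ℝ := (1 + 2 * p / dR a) ^ p * Real.exp (dR a / 2)

/-- [our constant] The value-profile constant of the R-column. -/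
def kV (a : ℝ) : ℝ := ghA0 a + (cG0 4 + cSplit 4 a) + cSm a * cAbs 2 a

/-- [our constant] The gradient-profile constant of the R-column. -/
def kP (a : ℝ) : ℝ := ghA1 a + 2 * (cG0 4 + cSplit 4 a) + cSm a * cAbs 3 a

variable {a : ℝ}

/-- [folklore] `0 ≤ cSm a`. -/
theorem cSm_nonneg (ha : 0 < a) : 0 ≤ cSm a :=
  mul_nonneg (mul_nonneg (cPPs_nonneg 4 ha) (cNear_nonneg ha)) (latticeConst_nonneg 4 (half_pos (ghDelta_pos ha)).le)

/-- [folklore] `1 ≤ cAbs p a`. -/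
theorem one_le_cAbs (ha : 0 < a) (p : ℕ) : 1 ≤ cAbs p a := by
  unfold cAbs
  have hd := dR_pos ha
  have hp0 : 0 ≤ 2 * (p : ℝ) / dR a := by positivity
  have h1 : (1 : ℝ) ≤ (1 + 2 * p / dR a) ^ p := one_le_pow₀ (by linarith)
  have h2 : (1 : ℝ) ≤ Real.exp (dR a / 2) := Real.one_le_exp_iff.2 (half_pos (dR_pos ha)).le
  nlinarith

/-- [folklore] `0 ≤ kV a` and `0 ≤ kP a`. -/
theorem kV_nonneg_and (ha : 0 < a) : 0 ≤ kV a ∧ 0 ≤ kP a := by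
  unfold kV kP; have := (ghA0_pos ha).le; have := ghA1_nonneg ha; have := cG0_nonneg 4; have := cSplit_nonneg 4 ha
  have := cSm_nonneg ha; have := one_le_cAbs ha 2; have := one_le_cAbs ha 3; constructor <;> positivity

variable (n : ℕ) [NeZero n]

/-- [folklore] **THE SMOOTH PART**: `|Σ'_z Pgt(x,z)·Ggh(z,s)| ≤ cSm a∕n⁴ · e^{−dR a·dist(blk x, blk s)}` (M4 sup ⊛ M10 block column). -/
theorem abs_comp_le (ha : 0 < a) (x s : X 4) :
    |∑' z : X 4, Pgt n a x z () () * Ggh n a z s () ()| ≤ cSm a / (n : ℝ) ^ 4 * Real.exp (-(dR a * dist (blk (n - 1) x) (blk (n - 1) s))) := by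
  have hn : (0 : ℝ) < n := Nat.cast_pos.mpr (Nat.pos_of_ne_zero (NeZero.ne n))
  have h := sum_abs_tsum_le_conv n ({x} : Finset (X 4)) (fun i z => Pgt n a i z () () * Ggh n a z s () ()) (fun i _ => summable_Pgt_mul_Ggh n ha i s)
    (f := fun w => cPPs 4 a / (n : ℝ) ^ 4 * Real.exp (-(deltaPP 4 a * dist (blk (n - 1) x) w))) (g := fun w => ∑ z ∈ B (n - 1) w, |Ggh n a z s () ()|)
    (deltaPP_pos 4 ha) (ghDelta_pos ha) (div_nonneg (cPPs_nonneg 4 ha) (pow_pos hn 4).le) (cNear_nonneg ha) (blk (n - 1) x) (blk (n - 1) s)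
    (fun w => ?_) (fun w => mul_nonneg (div_nonneg (cPPs_nonneg 4 ha) (pow_pos hn 4).le) (Real.exp_pos _).le)
    (fun w => Finset.sum_nonneg fun z _ => abs_nonneg _) (fun w => le_rfl) (sum_B_abs_Ggh_col_le n ha s)
  · rw [Finset.sum_singleton] at h
    refine h.trans (le_of_eq ?_)
    unfold cSm dR; ring
  · show ∑ z ∈ B (n - 1) w, ∑ i ∈ ({x} : Finset (X 4)), |Pgt n a i z () () * Ggh n a z s () ()|
      ≤ (cPPs 4 a / (n : ℝ) ^ 4 * Real.exp (-(deltaPP 4 a * dist (blk (n - 1) x) w))) * ∑ z ∈ B (n - 1) w, |Ggh n a z s () ()|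
    rw [Finset.mul_sum]
    refine Finset.sum_le_sum fun z hz => ?_
    rw [Finset.sum_singleton, abs_mul]
    refine mul_le_mul_of_nonneg_right ?_ (abs_nonneg _)
    have hP := abs_Pgt_le_sup n ha x z () ()
    rwa [mem_B.1 hz] at hP

/-- [folklore] **THE SMOOTH PART, x-GRADIENT**: `|Σ'_z (Pgt(x+e_ρ,z) − Pgt(x,z))·Ggh(z,s)| ≤ cSm a∕n⁵ · e^{−dR a·dist(blk x, blk s)}`. -/
theorem abs_comp_diff_le (ha : 0 < a) (x s : X 4) (ρ : Fin 4) :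
    |∑' z : X 4, (Pgt n a (x + unitVec ρ) z () () * Ggh n a z s () () - Pgt n a x z () () * Ggh n a z s () ())|
      ≤ cSm a / (n : ℝ) ^ 5 * Real.exp (-(dR a * dist (blk (n - 1) x) (blk (n - 1) s))) := by
  have hn : (0 : ℝ) < n := Nat.cast_pos.mpr (Nat.pos_of_ne_zero (NeZero.ne n))
  have h := sum_abs_tsum_le_conv n ({x} : Finset (X 4))
    (fun i z => Pgt n a (i + unitVec ρ) z () () * Ggh n a z s () () - Pgt n a i z () () * Ggh n a z s () ())
    (fun i _ => (summable_Pgt_mul_Ggh n ha (i + unitVec ρ) s).sub (summable_Pgt_mul_Ggh n ha i s))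
    (f := fun w => cPPs 4 a / (n : ℝ) ^ 5 * Real.exp (-(deltaPP 4 a * dist (blk (n - 1) x) w))) (g := fun w => ∑ z ∈ B (n - 1) w, |Ggh n a z s () ()|)
    (deltaPP_pos 4 ha) (ghDelta_pos ha) (div_nonneg (cPPs_nonneg 4 ha) (pow_pos hn 5).le) (cNear_nonneg ha) (blk (n - 1) x) (blk (n - 1) s)
    (fun w => ?_) (fun w => mul_nonneg (div_nonneg (cPPs_nonneg 4 ha) (pow_pos hn 5).le) (Real.exp_pos _).le)
    (fun w => Finset.sum_nonneg fun z _ => abs_nonneg _) (fun w => le_rfl) (sum_B_abs_Ggh_col_le n ha s)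
  · rw [Finset.sum_singleton] at h
    refine h.trans (le_of_eq ?_)
    unfold cSm dR; ring
  · show ∑ z ∈ B (n - 1) w, ∑ i ∈ ({x} : Finset (X 4)), |Pgt n a (i + unitVec ρ) z () () * Ggh n a z s () () - Pgt n a i z () () * Ggh n a z s () ()|
      ≤ (cPPs 4 a / (n : ℝ) ^ 5 * Real.exp (-(deltaPP 4 a * dist (blk (n - 1) x) w))) * ∑ z ∈ B (n - 1) w, |Ggh n a z s () ()|
    rw [Finset.mul_sum]
    refine Finset.sum_le_sum fun z hz => ?_
    rw [Finset.sum_singleton, ← sub_mul, abs_mul]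
    refine mul_le_mul_of_nonneg_right ?_ (abs_nonneg _)
    have hP := abs_Pgt_diff_le_sup n ha x z ρ () ()
    rw [mem_B.1 hz, show (e ρ : X 4) = unitVec ρ from rfl] at hP
    exact hP

/-- [folklore] **BLOCK GEOMETRY**: `‖x − s‖∞ + 1 ≤ n·(dist(blk x, blk s) + 1)` (`x_i = n·blk_i + loc_i`, `0 ≤ loc < n`). -/
theorem supNorm_sub_succ_le (x s : Pt) : (supNorm (x - s) : ℝ) + 1 ≤ (n : ℝ) * (dist (blk (n - 1) x) (blk (n - 1) s) + 1) := by
  set m : ℕ := n - 1 with hm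
  have hmn : ((m : ℝ) + 1) = n := cast_pred_add_one n
  rw [dist_eq_supNorm]
  set Db : ℕ := supNorm (blk m x - blk m s) with hDb
  have key : ∀ i : Fin 4, ((x - s) i).natAbs + 1 ≤ n * (Db + 1) := by
    intro i
    have h1 := natAbs_sub_le_blk m x s i
    have h2 : ((blk m x i - blk m s i).natAbs : ℝ) ≤ Db := by
      have : (blk m x i - blk m s i).natAbs ≤ Db := natAbs_le_supNorm (blk m x - blk m s) i
      exact_mod_cast this
    have h3 : (((x - s) i).natAbs : ℝ) ≤ ((m : ℝ) + 1) * Db + m := by nlinarith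
    have h4 : (((x - s) i).natAbs : ℝ) + 1 ≤ n * ((Db : ℝ) + 1) := by rw [← hmn]; linarith
    exact_mod_cast h4
  have hsup : supNorm (x - s) + 1 ≤ n * (Db + 1) := by
    have hpos : 1 ≤ n * (Db + 1) := le_trans (by simp) (key 0)
    have : supNorm (x - s) ≤ n * (Db + 1) - 1 := by
      rw [supNorm_eq, Beta.PoissonInterior.supNorm]
      exact Finset.sup_le fun i _ => by have := key i; omega
    omega
  exact_mod_cast hsup

/-- [folklore] Hence `nrm(x − s) ≤ n·(dist(blk x, blk s) + 1)`. -/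
theorem nrm_sub_le (x s : Pt) : nrm (x - s) ≤ (n : ℝ) * (dist (blk (n - 1) x) (blk (n - 1) s) + 1) := by
  have h := supNorm_sub_succ_le n x s
  have h0 : (0 : ℝ) ≤ (supNorm (x - s) : ℝ) := Nat.cast_nonneg _
  show max 1 ((Beta.PoissonInterior.supNorm (x - s) : ℕ) : ℝ) ≤ _
  rw [← supNorm_eq]
  exact max_le (by linarith) (by linarith)

omit [NeZero n] in
/-- [folklore] `(D + 1)·e^{−cD} ≤ 1 + 1∕c` for `c > 0`, `D ≥ 0` (`1 + cD ≤ e^{cD}`). -/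
theorem add_one_mul_exp_le {c D : ℝ} (hc : 0 < c) (hD : 0 ≤ D) : (D + 1) * Real.exp (-(c * D)) ≤ 1 + 1 / c := by
  have h := Real.add_one_le_exp (c * D)
  have hpos := Real.exp_pos (c * D)
  rw [Real.exp_neg, mul_inv_le_iff₀ hpos]
  have e1 : (1 + 1 / c) * (c * D + 1) = (D + 1) + (c * D + 1 / c) := by field_simp; ring
  have h3 : 0 ≤ c * D + 1 / c := by positivity
  have h2 : (D + 1) ≤ (1 + 1 / c) * (c * D + 1) := by rw [e1]; linarith
  exact h2.trans (mul_le_mul_of_nonneg_left h (by positivity))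

omit [NeZero n] in
/-- [folklore] `(D + 1)^p·e^{−cD} ≤ (1 + p∕c)^p` for `c > 0`, `D ≥ 0`, `p ≥ 1`. -/
theorem pow_succ_mul_exp_le {p : ℕ} (hp : 0 < p) {c D : ℝ} (hc : 0 < c) (hD : 0 ≤ D) :
    (D + 1) ^ p * Real.exp (-(c * D)) ≤ (1 + p / c) ^ p := by
  have hp0 : (p : ℝ) ≠ 0 := Nat.cast_ne_zero.2 hp.ne'
  have hcp : 0 < c / p := div_pos hc (Nat.cast_pos.2 hp)
  have h1 := add_one_mul_exp_le hcp hD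
  rw [one_div_div] at h1
  have e1 : Real.exp (-(c * D)) = Real.exp (-(c / p * D)) ^ p := by
    rw [← Real.exp_nat_mul]; congr 1; field_simp
  rw [e1, ← mul_pow]
  exact pow_le_pow_left₀ (mul_nonneg (by linarith) (Real.exp_pos _).le) h1 p

/-- [folklore] **ABSORPTION**: for `0 < N`, `0 ≤ D`, `N + 1 ≤ n(D+1)` and `p ≥ 1`,
`(n^p)⁻¹·e^{−dR·D} ≤ cAbs p a · e^{−(dR∕2∕n)·N} ∕ N^p` — the block factor `n^{−p}e^{−dR D}` IS a damped Coulomb profile in `N = ‖x−s‖∞`. -/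
theorem absorb (ha : 0 < a) {p : ℕ} (hp : 0 < p) {N D : ℝ} (hN : 0 < N) (hD : 0 ≤ D) (hND : N + 1 ≤ (n : ℝ) * (D + 1)) :
    ((n : ℝ) ^ p)⁻¹ * Real.exp (-(dR a * D)) ≤ cAbs p a * (Real.exp (-(dR a / 2 / n) * N) / N ^ p) := by
  have hn : (0 : ℝ) < n := Nat.cast_pos.mpr (Nat.pos_of_ne_zero (NeZero.ne n))
  have hd := dR_pos ha
  have hNle : N ≤ (n : ℝ) * (D + 1) := by linarith
  have h1 : ((n : ℝ) ^ p)⁻¹ ≤ (D + 1) ^ p / N ^ p := by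
    have h : (1 : ℝ) / n ≤ (D + 1) / N := by rw [div_le_div_iff₀ hn hN]; linarith
    calc ((n : ℝ) ^ p)⁻¹ = (1 / (n : ℝ)) ^ p := by rw [one_div, inv_pow]
      _ ≤ ((D + 1) / N) ^ p := pow_le_pow_left₀ (by positivity) h p
      _ = (D + 1) ^ p / N ^ p := div_pow _ _ _
  have h2 : (D + 1) ^ p * Real.exp (-(dR a / 2 * D)) ≤ (1 + 2 * p / dR a) ^ p := by
    have h := pow_succ_mul_exp_le hp (half_pos hd) hD
    rwa [show (p : ℝ) / (dR a / 2) = 2 * p / dR a by field_simp] at h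
  have h3 : Real.exp (-(dR a / 2 * D)) ≤ Real.exp (dR a / 2) * Real.exp (-(dR a / 2 / n) * N) := by
    rw [← Real.exp_add]
    apply Real.exp_le_exp.2
    have hdn : N / n ≤ D + 1 := by rw [div_le_iff₀ hn]; linarith
    have e2 : dR a / 2 / n * N = dR a / 2 * (N / n) := by field_simp
    rw [neg_mul, e2]
    nlinarith
  have e0 : Real.exp (-(dR a * D)) = Real.exp (-(dR a / 2 * D)) * Real.exp (-(dR a / 2 * D)) := by
    rw [← Real.exp_add]; ring_nf
  calc ((n : ℝ) ^ p)⁻¹ * Real.exp (-(dR a * D))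
      = ((n : ℝ) ^ p)⁻¹ * Real.exp (-(dR a / 2 * D)) * Real.exp (-(dR a / 2 * D)) := by rw [e0, mul_assoc]
    _ ≤ ((D + 1) ^ p / N ^ p * Real.exp (-(dR a / 2 * D))) * (Real.exp (dR a / 2) * Real.exp (-(dR a / 2 / n) * N)) :=
        mul_le_mul (mul_le_mul_of_nonneg_right h1 (Real.exp_pos _).le) h3 (Real.exp_pos _).le (by positivity)
    _ = ((D + 1) ^ p * Real.exp (-(dR a / 2 * D))) * Real.exp (dR a / 2) * (Real.exp (-(dR a / 2 / n) * N) / N ^ p) := by ring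
    _ ≤ (1 + 2 * p / dR a) ^ p * Real.exp (dR a / 2) * (Real.exp (-(dR a / 2 / n) * N) / N ^ p) :=
        mul_le_mul_of_nonneg_right (mul_le_mul_of_nonneg_right h2 (Real.exp_pos _).le) (by positivity)
    _ = cAbs p a * (Real.exp (-(dR a / 2 / n) * N) / N ^ p) := by rw [cAbs]

/-- [folklore] The off-diagonal data of a pair `x ≠ s`: `N = ‖x−s‖∞ > 0`, `nrm(x−s) = N`, `N + 1 ≤ n·(D+1)`. -/
theorem offDiag (x s : Pt) (hxs : x ≠ s) :
    0 < (supNorm (x - s) : ℝ) ∧ nrm (x - s) = (supNorm (x - s) : ℝ)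
      ∧ (supNorm (x - s) : ℝ) + 1 ≤ (n : ℝ) * (dist (blk (n - 1) x) (blk (n - 1) s) + 1) := by
  have hv : x - s ≠ 0 := sub_ne_zero.2 hxs
  refine ⟨?_, nrm_eq_supNorm hv, supNorm_sub_succ_le n x s⟩
  have : 0 < DyadicShell.supNorm (x - s) := DyadicShell.supNorm_pos hv
  exact_mod_cast this

/-- [folklore] The ghost rate dominates the damping rate: `e^{−(ghDelta∕n)N} ≤ e^{−(dR∕2∕n)N}` for `N ≥ 0`. -/
theorem exp_ghDelta_le_exp_half_dR (ha : 0 < a) {N : ℝ} (hN : 0 ≤ N) :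
    Real.exp (-(ghDelta a / n) * N) ≤ Real.exp (-(dR a / 2 / n) * N) := by
  have hn : (0 : ℝ) < n := Nat.cast_pos.mpr (Nat.pos_of_ne_zero (NeZero.ne n))
  have h : dR a / 2 ≤ ghDelta a := by
    unfold dR; have := min_le_right (deltaPP 4 a) (ghDelta a); linarith [ghDelta_pos ha]
  apply Real.exp_le_exp.2
  have h2 : dR a / 2 / n ≤ ghDelta a / n := div_le_div_of_nonneg_right h hn.le
  rw [neg_mul, neg_mul, neg_le_neg_iff]
  exact mul_le_mul_of_nonneg_right h2 hN

/-- [folklore] **THE VALUE PROFILE OF THE R-COLUMN** (every `x`, diagonal included):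
`|RG(x,s)| ≤ kV a∕n² · e^{−(dR a∕2∕n)·‖x−s‖∞} ∕ nrm(x−s)²`. -/
theorem abs_RG_le_profile (ha : 0 < a) (x s : X 4) :
    |RG (Ggh n a) (Pgt n a) x s () ()|
      ≤ kV a / (n : ℝ) ^ 2 * Real.exp (-(dR a / 2 / n) * Beta.PoissonInterior.supNorm (x - s)) / nrm (x - s) ^ 2 := by
  have hn : (0 : ℝ) < n := Nat.cast_pos.mpr (Nat.pos_of_ne_zero (NeZero.ne n))
  have hn1 : (1 : ℝ) ≤ n := by exact_mod_cast NeZero.one_le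
  have hC0 : 0 ≤ cG0 4 + cSplit 4 a := add_nonneg (cG0_nonneg 4) (cSplit_nonneg 4 ha)
  have hA0 : 0 ≤ ghA0 a := (ghA0_pos ha).le
  have hSm := cSm_nonneg ha
  have hAb := one_le_cAbs ha 2
  rw [← supNorm_eq, RG_apply]
  have hcomp := abs_comp_le n ha x s
  have hE1 : Real.exp (-(dR a * dist (blk (n - 1) x) (blk (n - 1) s))) ≤ 1 := by
    rw [Real.exp_le_one_iff, neg_nonpos]; exact mul_nonneg (dR_pos ha).le dist_nonneg
  refine (abs_sub _ _).trans ?_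
  by_cases hxs : x = s
  · subst hxs
    have h0 : (supNorm (x - x) : ℝ) = 0 := by
      rw [sub_self, supNorm_eq]; exact_mod_cast (supNorm_eq_zero_iff (d := 4)).2 rfl
    have hnrm : nrm (x - x) = 1 := by
      show max 1 ((Beta.PoissonInterior.supNorm (x - x) : ℕ) : ℝ) = 1
      rw [← supNorm_eq, h0]; simp
    rw [h0, hnrm, mul_zero, Real.exp_zero, mul_one, one_pow, div_one]
    have h1 := abs_Ggh_le_sharp n ha x x
    have h2 : |∑' z : X 4, Pgt n a x z () () * Ggh n a z x () ()| ≤ cSm a * cAbs 2 a / (n : ℝ) ^ 2 := by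
      refine hcomp.trans ?_
      calc cSm a / (n : ℝ) ^ 4 * Real.exp (-(dR a * dist (blk (n - 1) x) (blk (n - 1) x)))
          ≤ cSm a / (n : ℝ) ^ 4 * 1 := mul_le_mul_of_nonneg_left hE1 (by positivity)
        _ ≤ cSm a * cAbs 2 a / (n : ℝ) ^ 2 := by
            rw [mul_one, div_le_div_iff₀ (by positivity) (by positivity)]
            have : (n : ℝ) ^ 2 ≤ (n : ℝ) ^ 4 := pow_le_pow_right₀ hn1 (by norm_num)
            calc cSm a * (n : ℝ) ^ 2 ≤ cSm a * (n : ℝ) ^ 4 := mul_le_mul_of_nonneg_left this hSm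
              _ = cSm a * 1 * (n : ℝ) ^ 4 := by ring
              _ ≤ cSm a * cAbs 2 a * (n : ℝ) ^ 4 := mul_le_mul_of_nonneg_right (mul_le_mul_of_nonneg_left hAb hSm) (by positivity)
    calc |Ggh n a x x () ()| + |∑' z : X 4, Pgt n a x z () () * Ggh n a z x () ()|
        ≤ (cG0 4 + cSplit 4 a) / (n : ℝ) ^ 2 + cSm a * cAbs 2 a / (n : ℝ) ^ 2 := add_le_add h1 h2
      _ ≤ kV a / (n : ℝ) ^ 2 := by
          rw [← add_div]; apply div_le_div_of_nonneg_right _ (pow_pos hn 2).le; unfold kV; linarith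
  · obtain ⟨hN, hnrm, hND⟩ := offDiag n x s hxs
    set N : ℝ := (supNorm (x - s) : ℝ) with hNdef
    set D : ℝ := dist (blk (n - 1) x) (blk (n - 1) s) with hDdef
    rw [hnrm]
    have hG : |Ggh n a x s () ()| ≤ ghA0 a * (Real.exp (-(dR a / 2 / n) * N) / ((n : ℝ) ^ 2 * N ^ 2)) := by
      have h := abs_Ggh_le_of_ne n ha hxs
      rw [mul_div_assoc] at h
      exact h.trans (mul_le_mul_of_nonneg_left
        (div_le_div_of_nonneg_right (exp_ghDelta_le_exp_half_dR n ha hN.le) (by positivity)) hA0)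
    have hS : |∑' z : X 4, Pgt n a x z () () * Ggh n a z s () ()| ≤ cSm a * cAbs 2 a * (Real.exp (-(dR a / 2 / n) * N) / ((n : ℝ) ^ 2 * N ^ 2)) := by
      have hab := absorb n ha (p := 2) two_pos hN dist_nonneg hND
      refine hcomp.trans ?_
      calc cSm a / (n : ℝ) ^ 4 * Real.exp (-(dR a * D)) = cSm a / (n : ℝ) ^ 2 * (((n : ℝ) ^ 2)⁻¹ * Real.exp (-(dR a * D))) := by
            field_simp
        _ ≤ cSm a / (n : ℝ) ^ 2 * (cAbs 2 a * (Real.exp (-(dR a / 2 / n) * N) / N ^ 2)) := mul_le_mul_of_nonneg_left hab (by positivity)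
        _ = cSm a * cAbs 2 a * (Real.exp (-(dR a / 2 / n) * N) / ((n : ℝ) ^ 2 * N ^ 2)) := by field_simp
    calc |Ggh n a x s () ()| + |∑' z : X 4, Pgt n a x z () () * Ggh n a z s () ()|
        ≤ (ghA0 a + cSm a * cAbs 2 a) * (Real.exp (-(dR a / 2 / n) * N) / ((n : ℝ) ^ 2 * N ^ 2)) := by rw [add_mul]; exact add_le_add hG hS
      _ ≤ kV a * (Real.exp (-(dR a / 2 / n) * N) / ((n : ℝ) ^ 2 * N ^ 2)) :=
          mul_le_mul_of_nonneg_right (by unfold kV; linarith) (by positivity)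
      _ = kV a / (n : ℝ) ^ 2 * Real.exp (-(dR a / 2 / n) * N) / N ^ 2 := by field_simp

/-- [folklore] **THE GRADIENT PROFILE OF THE R-COLUMN** (every `x`, diagonal included):
`|RG(x+e_ρ,s) − RG(x,s)| ≤ kP a∕n² · e^{−(dR a∕2∕n)·‖x−s‖∞} ∕ nrm(x−s)³`. -/
theorem abs_RG_diff_le_profile (ha : 0 < a) (x s : X 4) (ρ : Fin 4) :
    |RG (Ggh n a) (Pgt n a) (x + unitVec ρ) s () () - RG (Ggh n a) (Pgt n a) x s () ()|
      ≤ kP a / (n : ℝ) ^ 2 * Real.exp (-(dR a / 2 / n) * Beta.PoissonInterior.supNorm (x - s)) / nrm (x - s) ^ 3 := by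
  have hn : (0 : ℝ) < n := Nat.cast_pos.mpr (Nat.pos_of_ne_zero (NeZero.ne n))
  have hn1 : (1 : ℝ) ≤ n := by exact_mod_cast NeZero.one_le
  have hC0 : 0 ≤ cG0 4 + cSplit 4 a := add_nonneg (cG0_nonneg 4) (cSplit_nonneg 4 ha)
  have hA1 : 0 ≤ ghA1 a := ghA1_nonneg ha
  have hSm := cSm_nonneg ha
  have hAb := one_le_cAbs ha 3
  set u : X 4 := unitVec ρ with hu
  have e1 : RG (Ggh n a) (Pgt n a) (x + u) s () () - RG (Ggh n a) (Pgt n a) x s () ()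
      = (Ggh n a (x + u) s () () - Ggh n a x s () ())
        - ∑' z : X 4, (Pgt n a (x + u) z () () * Ggh n a z s () () - Pgt n a x z () () * Ggh n a z s () ()) := by
    rw [RG_apply, RG_apply, (summable_Pgt_mul_Ggh n ha (x + u) s).tsum_sub (summable_Pgt_mul_Ggh n ha x s)]
    ring
  rw [← supNorm_eq, e1]
  have hcomp := abs_comp_diff_le n ha x s ρ
  have hE1 : Real.exp (-(dR a * dist (blk (n - 1) x) (blk (n - 1) s))) ≤ 1 := by
    rw [Real.exp_le_one_iff, neg_nonpos]; exact mul_nonneg (dR_pos ha).le dist_nonneg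
  refine (abs_sub _ _).trans ?_
  by_cases hxs : x = s
  · subst hxs
    have h0 : (supNorm (x - x) : ℝ) = 0 := by
      rw [sub_self, supNorm_eq]; exact_mod_cast (supNorm_eq_zero_iff (d := 4)).2 rfl
    have hnrm : nrm (x - x) = 1 := by
      show max 1 ((Beta.PoissonInterior.supNorm (x - x) : ℕ) : ℝ) = 1
      rw [← supNorm_eq, h0]; simp
    rw [h0, hnrm, mul_zero, Real.exp_zero, mul_one, one_pow, div_one]
    have h1 : |Ggh n a (x + u) x () () - Ggh n a x x () ()| ≤ 2 * (cG0 4 + cSplit 4 a) / (n : ℝ) ^ 2 := by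
      have ha1 := abs_Ggh_le_sharp n ha (x + u) x
      have ha2 := abs_Ggh_le_sharp n ha x x
      calc _ ≤ |Ggh n a (x + u) x () ()| + |Ggh n a x x () ()| := abs_sub _ _
        _ ≤ 2 * (cG0 4 + cSplit 4 a) / (n : ℝ) ^ 2 := by rw [mul_div_assoc]; linarith
    have h2 : |∑' z : X 4, (Pgt n a (x + u) z () () * Ggh n a z x () () - Pgt n a x z () () * Ggh n a z x () ())|
        ≤ cSm a * cAbs 3 a / (n : ℝ) ^ 2 := by
      refine hcomp.trans ?_
      calc cSm a / (n : ℝ) ^ 5 * Real.exp (-(dR a * dist (blk (n - 1) x) (blk (n - 1) x)))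
          ≤ cSm a / (n : ℝ) ^ 5 * 1 := mul_le_mul_of_nonneg_left hE1 (by positivity)
        _ ≤ cSm a * cAbs 3 a / (n : ℝ) ^ 2 := by
            rw [mul_one, div_le_div_iff₀ (by positivity) (by positivity)]
            have : (n : ℝ) ^ 2 ≤ (n : ℝ) ^ 5 := pow_le_pow_right₀ hn1 (by norm_num)
            calc cSm a * (n : ℝ) ^ 2 ≤ cSm a * (n : ℝ) ^ 5 := mul_le_mul_of_nonneg_left this hSm
              _ = cSm a * 1 * (n : ℝ) ^ 5 := by ring
              _ ≤ cSm a * cAbs 3 a * (n : ℝ) ^ 5 := mul_le_mul_of_nonneg_right (mul_le_mul_of_nonneg_left hAb hSm) (by positivity)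
    calc |Ggh n a (x + u) x () () - Ggh n a x x () ()|
          + |∑' z : X 4, (Pgt n a (x + u) z () () * Ggh n a z x () () - Pgt n a x z () () * Ggh n a z x () ())|
        ≤ 2 * (cG0 4 + cSplit 4 a) / (n : ℝ) ^ 2 + cSm a * cAbs 3 a / (n : ℝ) ^ 2 := add_le_add h1 h2
      _ ≤ kP a / (n : ℝ) ^ 2 := by
          rw [← add_div]; apply div_le_div_of_nonneg_right _ (pow_pos hn 2).le; unfold kP; linarith
  · obtain ⟨hN, hnrm, hND⟩ := offDiag n x s hxs
    set N : ℝ := (supNorm (x - s) : ℝ) with hNdef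
    set D : ℝ := dist (blk (n - 1) x) (blk (n - 1) s) with hDdef
    rw [hnrm]
    have hG : |Ggh n a (x + u) s () () - Ggh n a x s () ()| ≤ ghA1 a * (Real.exp (-(dR a / 2 / n) * N) / ((n : ℝ) ^ 2 * N ^ 3)) := by
      have h := abs_Ggh_diff_le_of_ne n ha hxs ρ
      rw [mul_div_assoc] at h
      exact h.trans (mul_le_mul_of_nonneg_left
        (div_le_div_of_nonneg_right (exp_ghDelta_le_exp_half_dR n ha hN.le) (by positivity)) hA1)
    have hS : |∑' z : X 4, (Pgt n a (x + u) z () () * Ggh n a z s () () - Pgt n a x z () () * Ggh n a z s () ())|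
        ≤ cSm a * cAbs 3 a * (Real.exp (-(dR a / 2 / n) * N) / ((n : ℝ) ^ 2 * N ^ 3)) := by
      have hab := absorb n ha (p := 3) (by norm_num) hN dist_nonneg hND
      refine hcomp.trans ?_
      calc cSm a / (n : ℝ) ^ 5 * Real.exp (-(dR a * D)) = cSm a / (n : ℝ) ^ 2 * (((n : ℝ) ^ 3)⁻¹ * Real.exp (-(dR a * D))) := by
            field_simp
        _ ≤ cSm a / (n : ℝ) ^ 2 * (cAbs 3 a * (Real.exp (-(dR a / 2 / n) * N) / N ^ 3)) := mul_le_mul_of_nonneg_left hab (by positivity)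
        _ = cSm a * cAbs 3 a * (Real.exp (-(dR a / 2 / n) * N) / ((n : ℝ) ^ 2 * N ^ 3)) := by field_simp
    calc |Ggh n a (x + u) s () () - Ggh n a x s () ()|
          + |∑' z : X 4, (Pgt n a (x + u) z () () * Ggh n a z s () () - Pgt n a x z () () * Ggh n a z s () ())|
        ≤ (ghA1 a + cSm a * cAbs 3 a) * (Real.exp (-(dR a / 2 / n) * N) / ((n : ℝ) ^ 2 * N ^ 3)) := by rw [add_mul]; exact add_le_add hG hS
      _ ≤ kP a * (Real.exp (-(dR a / 2 / n) * N) / ((n : ℝ) ^ 2 * N ^ 3)) :=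
          mul_le_mul_of_nonneg_right (by unfold kP; linarith) (by positivity)
      _ = kP a / (n : ℝ) ^ 2 * Real.exp (-(dR a / 2 / n) * N) / N ^ 3 := by field_simp

/-- [folklore] **UNDAMPED VALUE PROFILE**: `|RG(x,s)| ≤ (kV a∕n²) ∕ nrm(x−s)²` — the `hf`∕`hK` shape `A ∕ nrm(x − v)^b` of `LatticeHLSProfiles`. -/
theorem abs_RG_le_inv_sq (ha : 0 < a) (x s : X 4) : |RG (Ggh n a) (Pgt n a) x s () ()| ≤ kV a / (n : ℝ) ^ 2 / nrm (x - s) ^ 2 := by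
  have hn : (0 : ℝ) < n := Nat.cast_pos.mpr (Nat.pos_of_ne_zero (NeZero.ne n))
  refine (abs_RG_le_profile n ha x s).trans (div_le_div_of_nonneg_right ?_ (pow_pos (nrm_pos _) 2).le)
  have hkV : 0 ≤ kV a / (n : ℝ) ^ 2 := div_nonneg (kV_nonneg_and ha).1 (pow_pos hn 2).le
  have hE : Real.exp (-(dR a / 2 / n) * Beta.PoissonInterior.supNorm (x - s)) ≤ 1 := by
    rw [Real.exp_le_one_iff, neg_mul, neg_nonpos]; exact mul_nonneg (by have := dR_pos ha; positivity) (Nat.cast_nonneg _)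
  exact (mul_le_mul_of_nonneg_left hE hkV).trans (le_of_eq (mul_one _))

/-- [folklore] **UNDAMPED GRADIENT PROFILE**: `|RG(x+e_ρ,s) − RG(x,s)| ≤ (kP a∕n²) ∕ nrm(x−s)³`. -/
theorem abs_RG_diff_le_inv_cube (ha : 0 < a) (x s : X 4) (ρ : Fin 4) :
    |RG (Ggh n a) (Pgt n a) (x + unitVec ρ) s () () - RG (Ggh n a) (Pgt n a) x s () ()| ≤ kP a / (n : ℝ) ^ 2 / nrm (x - s) ^ 3 := by
  have hn : (0 : ℝ) < n := Nat.cast_pos.mpr (Nat.pos_of_ne_zero (NeZero.ne n))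
  refine (abs_RG_diff_le_profile n ha x s ρ).trans (div_le_div_of_nonneg_right ?_ (pow_pos (nrm_pos _) 3).le)
  have hkP : 0 ≤ kP a / (n : ℝ) ^ 2 := div_nonneg (kV_nonneg_and ha).2 (pow_pos hn 2).le
  have hE : Real.exp (-(dR a / 2 / n) * Beta.PoissonInterior.supNorm (x - s)) ≤ 1 := by
    rw [Real.exp_le_one_iff, neg_mul, neg_nonpos]; exact mul_nonneg (by have := dR_pos ha; positivity) (Nat.cast_nonneg _)
  exact (mul_le_mul_of_nonneg_left hE hkP).trans (le_of_eq (mul_one _))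

end

end Summit.QuantumFields.BalabanUV.Beta.D1BFx.RColumnProfile
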